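import Summits.CriticalPhenomena.PercolationContinuityZ3.Theorems.Transplant.PlanarSkeletonFrmFromDefs
import Summits.CriticalPhenomena.PercolationContinuityZ3.Theorems.Transplant.SkelFrmFromBChoiceResidC
import Summits.CriticalPhenomena.PercolationContinuityZ3.Theorems.Transplant.SkelFrmBChoiceResidC
import Summits.CriticalPhenomena.PercolationContinuityZ3.Theorems.Transplant.SkelFrmFromBParamsFaceFloorsZPiYA
import Summits.CriticalPhenomena.PercolationContinuityZ3.Theorems.Transplant.SkelFrmBParamsFaceFloorsZPiYA
import HarnessLib
import Summits.CriticalPhenomena.PercolationContinuityZ3.Theorems.Transplant.SkelFrmBChoiceResidF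
/-!
# U-WAVE PORT (RULING D-U, lead g21 2026-08-26; WAVE-U-MANIFEST v3.0 row «SkelFrmBChoiceResidF» ↦ «SkelFrmFromBChoiceResidF») of the tree module
# `Transplant/SkelFrmBChoiceResidF` onto the carrier `PlanarSkeletonFrmFrom` (frames only, cylinders connected from width `ℓ₀` on)

ORIGINAL TITLE: N2 (frames-only node `SamePDropOfSkeletonFrm₁`, OPEN) — (ζ″) ledger: THE (F)-COLUMN RESIDUAL SLOT FUNCTIONS `NegB.gxFc / fxFc / exFc` AND THEIR FLOOR LEMMAS

builds on p205010 (kernel theorem, internal audit signed; external expert review pending) — nothing in this file uses p205010; NOTHING is claimed about the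
OPEN node U `SamePDropOfSkeletonFrmFrom₁` (nor U_s / the end state).  Lane `prim-bschramm`, seat `prim-hp-8 gen 53 (U-wave port pen, family P-hp8; tool of record = p3-g26 port_u.py)`; helper file
(`--supports stmt-CriticalPhenomena-4575 --as helper`).  PORT RULES r1–r4 of RULING D-U: declaration order and proof texts are those of the original,
byte-identical except (i) the carrier token `PlanarSkeletonFrm ↦ PlanarSkeletonFrmFrom` (binders, `namespace`/`end` lines, qualified names of twinned
declarations), (ii) carrier-FREE declarations of the original (φ-level `Skelφ…` blocks and namespace-only arithmetic residents) are NOT re-declared —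
this file imports the original and `export`s the twin-free residents (POLICY T / treatment (m1)); residents whose statement mentions a twinned
constant are copied, (iii) every carrier-binding declaration keeps its explicit binder `(Φ : PlanarSkeletonFrmFrom G)` in its own signature (r2).  Docstrings and citations are the original's.  Manifest row idx 206 (level 21; flags verbatim|DEF-ROW); filed by the hp-8 lineage under RULING M-11 (family P-hp8).
-/

noncomputable section

open scoped Classical

namespace Summit.CriticalPhenomena.PercolationContinuityZ3.Theorems.Transplant

namespace PlanarSkeletonFrmFrom

namespace NegB

open Literature.Probability.Percolation Literature.Probability.LatticeModels SimpleGraph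
open SkelConc (Consts)
open Skelφ.StepI (DataNS OutNS)
open Neg

/-! ## §1 The (F)-column residual slot functions -/

/-- **The (F)-column BOX residual** `gxFc mk c := max {22000·Kq·(R′0+2), 64·S_F c mk}`. [this work] -/
def gxFc (mk c : ℕ) : Neg.FSlot := fun κ _ _ _ _ _ Φ t p D =>
  max (22000 * Neg.Kq κ * (KS0.R'0 κ Φ t p D mk + 2)) (64 * KS.SF κ Φ t p D c mk)

/-- **The (F)-column WIDTH residual** `fxFc mk := 2400·Kq·(R′0+2)`. [this work] -/
def fxFc (mk : ℕ) : Neg.FSlot := fun κ _ _ _ _ _ Φ t p D => 2400 * Neg.Kq κ * (KS0.R'0 κ Φ t p D mk + 2)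

/-- **The (F)-column EXCESS residual** `exFc mk c := max {πBudX c mk g f, πBudY c mk g f}`. [this work] -/
def exFc (mk c : ℕ) : GSlot := fun κ _ _ _ _ _ Φ t p D g f => max (KS.πBudX κ Φ t p D c mk g f) (KS.πBudY κ Φ t p D c mk g f)

section Floors

variable (κ : Consts) {V : Type} [DecidableEq V] [Countable V] {G : SimpleGraph V} [G.LocallyFinite] (Φ : PlanarSkeletonFrmFrom G) (t : V) (p : unitInterval)
  (D : DataNS V) (g f mk c : ℕ)

/-- `gxFc` by name. [folklore] -/
theorem gxFc_at (κ : Consts) {V : Type} [DecidableEq V] [Countable V] {G : SimpleGraph V} [G.LocallyFinite] (Φ : PlanarSkeletonFrmFrom G) (t : V) (p : unitInterval) (D : DataNS V) (mk : ℕ) (c : ℕ) : gxFc mk c κ Φ t p D = max (22000 * Neg.Kq κ * (KS0.R'0 κ Φ t p D mk + 2)) (64 * KS.SF κ Φ t p D c mk) := rfl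

/-- `fxFc` by name. [folklore] -/
theorem fxFc_at (κ : Consts) {V : Type} [DecidableEq V] [Countable V] {G : SimpleGraph V} [G.LocallyFinite] (Φ : PlanarSkeletonFrmFrom G) (t : V) (p : unitInterval) (D : DataNS V) (mk : ℕ) : fxFc mk κ Φ t p D = 2400 * Neg.Kq κ * (KS0.R'0 κ Φ t p D mk + 2) := rfl

/-- `exFc` by name. [folklore] -/
theorem exFc_at (κ : Consts) {V : Type} [DecidableEq V] [Countable V] {G : SimpleGraph V} [G.LocallyFinite] (Φ : PlanarSkeletonFrmFrom G) (t : V) (p : unitInterval) (D : DataNS V) (g : ℕ) (f : ℕ) (mk : ℕ) (c : ℕ) : exFc mk c κ Φ t p D g f = max (KS.πBudX κ Φ t p D c mk g f) (KS.πBudY κ Φ t p D c mk g f) := rfl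

/-- **The two box floors inside `gxFc`.** [folklore] -/
theorem gxFc_floors (κ : Consts) {V : Type} [DecidableEq V] [Countable V] {G : SimpleGraph V} [G.LocallyFinite] (Φ : PlanarSkeletonFrmFrom G) (t : V) (p : unitInterval) (D : DataNS V) (mk : ℕ) (c : ℕ) : 22000 * Neg.Kq κ * (KS0.R'0 κ Φ t p D mk + 2) ≤ gxFc mk c κ Φ t p D ∧ 64 * KS.SF κ Φ t p D c mk ≤ gxFc mk c κ Φ t p D := by
  refine ⟨?_, ?_⟩ <;> rw [gxFc_at] <;> omega

/-- **The two reach budgets inside `exFc`.** [folklore] -/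
theorem exFc_floors (κ : Consts) {V : Type} [DecidableEq V] [Countable V] {G : SimpleGraph V} [G.LocallyFinite] (Φ : PlanarSkeletonFrmFrom G) (t : V) (p : unitInterval) (D : DataNS V) (g : ℕ) (f : ℕ) (mk : ℕ) (c : ℕ) : KS.πBudX κ Φ t p D c mk g f ≤ exFc mk c κ Φ t p D g f ∧ KS.πBudY κ Φ t p D c mk g f ≤ exFc mk c κ Φ t p D g f := by
  refine ⟨?_, ?_⟩ <;> rw [exFc_at] <;> omega

/-- The width floor inside `fxFc` (equality). [folklore] -/
theorem fxFc_floor (κ : Consts) {V : Type} [DecidableEq V] [Countable V] {G : SimpleGraph V} [G.LocallyFinite] (Φ : PlanarSkeletonFrmFrom G) (t : V) (p : unitInterval) (D : DataNS V) (mk : ℕ) : 2400 * Neg.Kq κ * (KS0.R'0 κ Φ t p D mk + 2) ≤ fxFc mk κ Φ t p D := le_of_eq (fxFc_at κ Φ t p D mk).symm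

end Floors

/-! ## §2 Transfer to any dominating slot value (the node file's `gxQ/fxQ/exQ ⊒ gxFc/fxFc/exFc`) -/

section Transfer

variable {κ : Consts} {V : Type} [DecidableEq V] [Countable V] {G : SimpleGraph V} [G.LocallyFinite] {Φ : PlanarSkeletonFrmFrom G} {t : V} {p : unitInterval}
  {mk c : ℕ}

/-- **J19 box floors at `g := KS.gT mk gx`** from any box residual dominating `gxFc`: `22000·Kq·(R′0+2) ≤ M_L` and the Kq-free `22000·(R′0+2) ≤ M_L`
(the HA files' `hMR0`/`hR0`). [folklore] -/
theorem hR0F_of_ge {κ : Consts} {V : Type} [DecidableEq V] [Countable V] {G : SimpleGraph V} [G.LocallyFinite] {Φ : PlanarSkeletonFrmFrom G} {t : V} {p : unitInterval} {mk : ℕ} {c : ℕ} {gx : Neg.FSlot} (h : ∀ D : DataNS V, gxFc mk c κ Φ t p D ≤ gx κ Φ t p D) (D : DataNS V) :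
    22000 * Neg.Kq κ * (KS0.R'0 κ Φ t p D mk + 2) ≤ ML κ Φ t p D (KS.gT mk gx κ Φ t p D) ∧
      22000 * (KS0.R'0 κ Φ t p D mk + 2) ≤ ML κ Φ t p D (KS.gT mk gx κ Φ t p D) := by
  have h1 := (gxFc_floors κ Φ t p D mk c).1.trans ((h D).trans ((KS.gT_floors κ Φ t p D mk gx).2.2.2.trans (ML_le_ML κ Φ t p D _).2))
  have hKq := Neg.one_le_Kq κ
  refine ⟨h1, le_trans ?_ h1⟩
  calc 22000 * (KS0.R'0 κ Φ t p D mk + 2) = 22000 * 1 * (KS0.R'0 κ Φ t p D mk + 2) := by ring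
    _ ≤ 22000 * Neg.Kq κ * (KS0.R'0 κ Φ t p D mk + 2) := by gcongr

/-- **`hS64 : 64·S_F ≤ M_L (KS.gT mk gx)`** from any box residual dominating `gxFc`. [folklore] -/
theorem hS64_of_ge {κ : Consts} {V : Type} [DecidableEq V] [Countable V] {G : SimpleGraph V} [G.LocallyFinite] {Φ : PlanarSkeletonFrmFrom G} {t : V} {p : unitInterval} {mk : ℕ} {c : ℕ} {gx : Neg.FSlot} (h : ∀ D : DataNS V, gxFc mk c κ Φ t p D ≤ gx κ Φ t p D) (D : DataNS V) :
    64 * KS.SF κ Φ t p D c mk ≤ ML κ Φ t p D (KS.gT mk gx κ Φ t p D) :=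
  (gxFc_floors κ Φ t p D mk c).2.trans ((h D).trans ((KS.gT_floors κ Φ t p D mk gx).2.2.2.trans (ML_le_ML κ Φ t p D _).2))

/-- **`hS : 16·S_F ≤ M_L (KS.gT mk gx)`** (from `hS64`). [folklore] -/
theorem hS_of_ge {κ : Consts} {V : Type} [DecidableEq V] [Countable V] {G : SimpleGraph V} [G.LocallyFinite] {Φ : PlanarSkeletonFrmFrom G} {t : V} {p : unitInterval} {mk : ℕ} {c : ℕ} {gx : Neg.FSlot} (h : ∀ D : DataNS V, gxFc mk c κ Φ t p D ≤ gx κ Φ t p D) (D : DataNS V) :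
    16 * KS.SF κ Φ t p D c mk ≤ ML κ Φ t p D (KS.gT mk gx κ Φ t p D) :=
  le_trans (by omega) (hS64_of_ge h D)

/-- **J19 `hℓA`**: `22000·Kq·(R′0+2) ≤ ℓ_L` at `KS.gT mk gx`, under the numeric long clause (`M_L + 1 ≤ ℓ_L`). [folklore] -/
theorem hℓAF_of_ge {κ : Consts} {V : Type} [DecidableEq V] [Countable V] {G : SimpleGraph V} [G.LocallyFinite] {Φ : PlanarSkeletonFrmFrom G} {t : V} {p : unitInterval} {mk : ℕ} {c : ℕ} {gx : Neg.FSlot} (h : ∀ D : DataNS V, gxFc mk c κ Φ t p D ≤ gx κ Φ t p D) (D : DataNS V) {f : ℕ}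
    (hN : EqNumL κ Φ t p D (KS.gT mk gx κ Φ t p D) f) : 22000 * Neg.Kq κ * (KS0.R'0 κ Φ t p D mk + 2) ≤ ℓL κ Φ t p D (KS.gT mk gx κ Φ t p D) f := by
  have h1 := (hR0F_of_ge h D).1
  have h2 := hN.ℓ_le
  have h1' : ((22000 * Neg.Kq κ * (KS0.R'0 κ Φ t p D mk + 2) : ℕ) : ℤ) ≤ (ML κ Φ t p D (KS.gT mk gx κ Φ t p D) : ℤ) := by exact_mod_cast h1
  have : ((22000 * Neg.Kq κ * (KS0.R'0 κ Φ t p D mk + 2) : ℕ) : ℤ) ≤ (ℓL κ Φ t p D (KS.gT mk gx κ Φ t p D) f : ℕ) := by linarith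
  exact_mod_cast this

/-- **`hnA24`**: `2400·Kq·(R′0+2) ≤ n_L g (KS.fT mk fx)` from any width residual dominating `fxFc` (EqNumL-free, any box value `g`). [folklore] -/
theorem hnA24_of_ge {κ : Consts} {V : Type} [DecidableEq V] [Countable V] {G : SimpleGraph V} [G.LocallyFinite] {Φ : PlanarSkeletonFrmFrom G} {t : V} {p : unitInterval} {mk : ℕ} {fx : Neg.FSlot} (h : ∀ D : DataNS V, fxFc mk κ Φ t p D ≤ fx κ Φ t p D) (D : DataNS V) (g : ℕ) :
    2400 * Neg.Kq κ * (KS0.R'0 κ Φ t p D mk + 2) ≤ nL κ Φ t p D g (KS.fT mk fx κ Φ t p D) :=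
  (fxFc_floor κ Φ t p D mk).trans ((h D).trans (((KS.fT_floors κ Φ t p D mk fx).2.2.2).trans (n₁L_le_nL κ Φ t p D g _).2))

/-- **`hnA`**: `2000·Kq·(R′0+2) ≤ n_L g (KS.fT mk fx)` (from `hnA24`). [folklore] -/
theorem hnAF_of_ge {κ : Consts} {V : Type} [DecidableEq V] [Countable V] {G : SimpleGraph V} [G.LocallyFinite] {Φ : PlanarSkeletonFrmFrom G} {t : V} {p : unitInterval} {mk : ℕ} {fx : Neg.FSlot} (h : ∀ D : DataNS V, fxFc mk κ Φ t p D ≤ fx κ Φ t p D) (D : DataNS V) (g : ℕ) :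
    2000 * Neg.Kq κ * (KS0.R'0 κ Φ t p D mk + 2) ≤ nL κ Φ t p D g (KS.fT mk fx κ Φ t p D) :=
  le_trans (Nat.mul_le_mul_right _ (Nat.mul_le_mul_right _ (by norm_num))) (hnA24_of_ge h D g)

/-- **`hRn0`**: `R′0 ≤ n_L g (KS.fT mk fx)` (from `hnA`). [folklore] -/
theorem hRn0F_of_ge {κ : Consts} {V : Type} [DecidableEq V] [Countable V] {G : SimpleGraph V} [G.LocallyFinite] {Φ : PlanarSkeletonFrmFrom G} {t : V} {p : unitInterval} {mk : ℕ} {fx : Neg.FSlot} (h : ∀ D : DataNS V, fxFc mk κ Φ t p D ≤ fx κ Φ t p D) (D : DataNS V) (g : ℕ) :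
    KS0.R'0 κ Φ t p D mk ≤ nL κ Φ t p D g (KS.fT mk fx κ Φ t p D) := by
  have h1 := hnAF_of_ge h D g
  have hKq := Neg.one_le_Kq κ
  have : KS0.R'0 κ Φ t p D mk ≤ 2000 * Neg.Kq κ * (KS0.R'0 κ Φ t p D mk + 2) := by nlinarith
  exact this.trans h1

/-- **The x-face reach budget** `πBudX ≤ ex` from any excess residual dominating `exFc` (the assemblies take `hr : πBudX ≤ r` with `ex ≤ r`). [folklore] -/
theorem hπX_of_ge {κ : Consts} {V : Type} [DecidableEq V] [Countable V] {G : SimpleGraph V} [G.LocallyFinite] {Φ : PlanarSkeletonFrmFrom G} {t : V} {p : unitInterval} {mk : ℕ} {c : ℕ} {ex : GSlot} (h : ∀ (D : DataNS V) (g f : ℕ), exFc mk c κ Φ t p D g f ≤ ex κ Φ t p D g f) (D : DataNS V) (g f : ℕ) :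
    KS.πBudX κ Φ t p D c mk g f ≤ ex κ Φ t p D g f :=
  (exFc_floors κ Φ t p D g f mk c).1.trans (h D g f)

/-- **The y′-face reach budget** `πBudY ≤ ex` from any excess residual dominating `exFc`. [folklore] -/
theorem hπY_of_ge {κ : Consts} {V : Type} [DecidableEq V] [Countable V] {G : SimpleGraph V} [G.LocallyFinite] {Φ : PlanarSkeletonFrmFrom G} {t : V} {p : unitInterval} {mk : ℕ} {c : ℕ} {ex : GSlot} (h : ∀ (D : DataNS V) (g f : ℕ), exFc mk c κ Φ t p D g f ≤ ex κ Φ t p D g f) (D : DataNS V) (g f : ℕ) :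
    KS.πBudY κ Φ t p D c mk g f ≤ ex κ Φ t p D g f :=
  (exFc_floors κ Φ t p D g f mk c).2.trans (h D g f)

end Transfer

end NegB

end PlanarSkeletonFrmFrom

end Summit.CriticalPhenomena.PercolationContinuityZ3.Theorems.Transplant

end
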